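import Literature.AlgebraicGeometry.HodgeTheory.RationallyChainConnectedChowRankOneHodge
import Literature.AlgebraicGeometry.HodgeTheory.BettiNumbersEulerCharacteristic
import Literature.AlgebraicGeometry.HodgeTheory.BettiIrregularityHodgeTateType
import HarnessLib

/-!
# Varieties with `CH₀, …, CH_{k₀}` of rank `≤ 1` and `dim X ≤ 2k₀ + 2` are of HODGE–TATE TYPE (`h^{p,q} = 0` for all `p ≠ q`): `b_{2p+1} = 0`, `b_{2p} = h^{p,p}`, `E(X) = Σ_p h^{p,p} ≥ dim X + 1 > 0` — surfaces with
# `CH₀ = ℤ` (`e ≥ 3`), rationally chain connected surfaces, fourfolds with `CH₀ = CH₁ = ℚ` (`e ≥ 5`), sixfolds with `CH₀ = CH₁ = CH₂ = ℚ` (`e ≥ 7`)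
# (Voisin II Thm. 10.31; Laterveer 1998; Bloch–Srinivas 1983; Voisin I Cor. 6.13, §7.1.2; Hirzebruch §15.8; Kollár 1996)

Family `hodge`, lane `lit-hodgefound` (Track 2 foundations library; Layers A1/A4), layer `Literature/AlgebraicGeometry/HodgeTheory`.  THEOREMS ONLY (no definition, no named fact, no instance;
D-0026 net debt `0`).  Sequel of the seat's g33-#10 (`BettiUniverse.hodgeNumber_eq_zero_of_chowRankLEOneUpTo`: Voisin II Thm. 10.31 at every level) and g33-#13 (`IsRationallyChainConnected.chowRankLEOneUpTo_zero`),
feeding the tree's Hodge–Tate-type API (`BettiNumbersEulerCharacteristic` §HodgeTateType, `BettiIrregularityHodgeTateType`: hypothesis `hHT : ∀ k p q, p + q = k → p ≠ q → h^{p,q}(Hᵏ X) = 0`).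

THE ARGUMENT.  Let `p + q = k`, `p ≠ q`.  If `p > n` or `q > n` the Hodge number vanishes (no `(p,q)`-forms).  If `min(p, q) ≤ k₀`, Thm. 10.31 (g33-#10).  Otherwise `p, q ≥ k₀ + 1`, `p ≠ q`, so
`max(p, q) ≥ k₀ + 2` and, by Serre–Poincaré duality `h^{p,q}(Hᵏ) = h^{n−p,n−q}(H^{2n−k})`, the dual pair has `min(n − p, n − q) = n − max(p, q) ≤ n − k₀ − 2 ≤ k₀` (as `n ≤ 2k₀ + 2`) and is again
killed by Thm. 10.31.  The consequences are the tree's Hodge–Tate theorems.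

WHAT IS PROVED (`0` sorrys; every statement a theorem).
* §1 **`BettiUniverse.hodgeTateType_of_chowRankLEOneUpTo`** (`dim X ≤ 2k₀ + 2` ⟹ `h^{p,q} = 0` for `p ≠ q`, all degrees); `BettiUniverse.finrank_bettiCohomology_two_mul_eq_hodgeNumber_of_chowRankLEOneUpTo` (`b_{2p} = h^{p,p}`),
  `BettiUniverse.finrank_bettiCohomology_eq_zero_of_chowRankLEOneUpTo_of_odd` (`b_{2p+1} = 0`), `BettiUniverse.eulerChar_eq_sum_hodgeNumber_of_chowRankLEOneUpTo`, **`BettiUniverse.succ_le_eulerChar_of_chowRankLEOneUpTo`**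
  (`E(X) ≥ dim X + 1`), `BettiUniverse.eulerChar_pos_of_chowRankLEOneUpTo`.
* §2 Instances: surfaces with `CH₀ ⊗ ℚ` of rank `≤ 1` and rationally chain connected surfaces (`E ≥ 3`), Fano surfaces granted KMM92, fourfolds with `CH₀, CH₁` of rank `≤ 1` (`E ≥ 5`), sixfolds with
  `CH₀, CH₁, CH₂` of rank `≤ 1` (`E ≥ 7`).

THE PRINTS.  C. Voisin (2003) [VoisinHodgeII2003] §10.3.1 Thm. 10.29, Thm. 10.31, §10.2.2 Thm. 10.17; R. Laterveer (1998) [Laterveer1998]; S. Bloch, V. Srinivas (1983) [BlochSrinivas1983] Thm. 1; C. Voisin (2002) [VoisinHodgeI2002]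
§6.1.3 Cor. 6.13, §3.1.3 Cor. 3.9, §7.1.2; F. Hirzebruch (1966) [Hirzebruch1966] §15.8 Thm. 15.8.1; N. Yui (2013) [Yui2013] §1.4; J. Kollár (1996) [Kollar1995] Def. 4.10; KMM (1992) [KollarMiyaokaMori1992] Thm. 3.3.

THE OBJECTS (all the tree's).  `BettiUniverse.hodge`, `HodgeStructure.hodgeNumber`, `bettiCohomology`, `Motives.ChowRankLEOneUpTo`, `IsRationallyChainConnected`, `IsFano`; the tree's `BettiUniverse.hodgeNumber_hodge_eq_zero_of_lt_fst/snd`,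
`BettiUniverse.hodgeNumber_hodge_duality`, `BettiUniverse.finrank_bettiCohomology_two_mul_eq_hodgeNumber_of_hodgeTateType`, `BettiUniverse.finrank_bettiCohomology_eq_zero_of_hodgeTateType`,
`BettiUniverse.eulerChar_eq_sum_hodgeNumber_of_hodgeTateType`, `BettiUniverse.succ_le_eulerChar_of_hodgeTateType`, `BettiUniverse.eulerChar_pos_of_hodgeTateType`, and the seat's
`BettiUniverse.hodgeNumber_eq_zero_of_chowRankLEOneUpTo`, `IsRationallyChainConnected.chowRankLEOneUpTo_zero`.

DEVIATIONS / SCOPE.  «Hodge–Tate type» is the tree's hypothesis shape `hHT`, not a new definition; `E(X)` is the tree's alternating sum of `dim_ℚ Hᵏ(X(ℂ); ℚ)`.  Nothing beyond `dim X ≤ 2k₀ + 2`.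

## References
* [VoisinHodgeII2003] C. Voisin, *Hodge Theory and Complex Algebraic Geometry II* — Thm. 10.29, Thm. 10.31, Thm. 10.17.
* [Laterveer1998] R. Laterveer, J. Math. Kyoto Univ. 38 (1998) — main theorem.
* [BlochSrinivas1983] S. Bloch, V. Srinivas, Amer. J. Math. 105 (1983) — Thm. 1.
* [VoisinHodgeI2002] C. Voisin, *Hodge Theory and Complex Algebraic Geometry I* — §6.1.3 Cor. 6.13; §3.1.3 Cor. 3.9; §7.1.2.
* [Hirzebruch1966] F. Hirzebruch, *Topological Methods in Algebraic Geometry* — §15.8 Thm. 15.8.1.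
* [Yui2013] N. Yui (2013) — §1.4.
* [Kollar1995] J. Kollár, *Rational Curves on Algebraic Varieties* — Def. 4.10.
* [KollarMiyaokaMori1992] J. Kollár, Y. Miyaoka, S. Mori, J. Differential Geom. 36 (1992) — Thm. 3.3.

## Provenance
Lane `lit-hodgefound` (summit `HodgeConjecture`, Track 2 foundations), seat `lit-hodgefound-p29` (literature-prover, generation 33, row g33-#16).
-/

noncomputable section

open CategoryTheory AlgebraicGeometry Module Finset
open Literature.AlgebraicTopology.SingularHomology
open Literature.Geometry.Kaehler

namespace Literature.AlgebraicGeometry.HodgeTheory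

open Literature.AlgebraicGeometry.Motives
open Literature.AlgebraicGeometry.Motives.HodgeStructure

variable {n : ℕ} {X : SchemeOver ℂ}

/-! ### §1 Hodge–Tate type from small Chow groups -/

/-- **A smooth projective `n`-fold with `CH₀, …, CH_{k₀}` of rank `≤ 1` and `n ≤ 2k₀ + 2` is of Hodge–Tate type: `h^{p,q}(Hᵏ(X)) = 0` for all `p ≠ q`** (Voisin II Thm. 10.31 below `k₀`, Serre–Poincaré duality
for the rest). [cite: VoisinHodgeII2003, Thm. 10.31 (statement and proof) and Thm. 10.29] [cite: Laterveer1998, main theorem (as quoted in Vial2013 Thm. 7.1)] [cite: VoisinHodgeI2002, §6.1.3 Cor. 6.13 and §5.3] -/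
theorem BettiUniverse.hodgeTateType_of_chowRankLEOneUpTo (hHD : exists_isReal_hodgeModel) (hX : IsSmoothProjective n X) {k₀ : ℕ} (hCH : ChowRankLEOneUpTo X k₀) (hn : n ≤ 2 * k₀ + 2) :
    ∀ k p q : ℕ, p + q = k → p ≠ q → (BettiUniverse.hodge hHD hX k).hodgeNumber p q = 0 := by
  intro k p q hpq hne
  by_cases hp : n < p
  · exact BettiUniverse.hodgeNumber_hodge_eq_zero_of_lt_fst hHD hX hpq hp
  by_cases hq : n < q
  · exact BettiUniverse.hodgeNumber_hodge_eq_zero_of_lt_snd hHD hX hpq hq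
  rcases Nat.lt_or_gt_of_ne hne with hlt | hgt
  · by_cases hpk : p ≤ k₀
    · exact (BettiUniverse.hodgeNumber_eq_zero_of_chowRankLEOneUpTo hHD hX hCH hpq hpk hlt).1
    · subst hpq
      rw [BettiUniverse.hodgeNumber_hodge_duality hHD hX (p' := n - p) (q' := n - q) (by omega) (by omega)]
      exact (BettiUniverse.hodgeNumber_eq_zero_of_chowRankLEOneUpTo hHD hX hCH (show (n - q) + (n - p) = n - p + (n - q) by omega)
        (show n - q ≤ k₀ by omega) (show n - q < n - p by omega)).2
  · by_cases hqk : q ≤ k₀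
    · exact (BettiUniverse.hodgeNumber_eq_zero_of_chowRankLEOneUpTo hHD hX hCH (show q + p = k by omega) hqk hgt).2
    · subst hpq
      rw [BettiUniverse.hodgeNumber_hodge_duality hHD hX (p' := n - p) (q' := n - q) (by omega) (by omega)]
      exact (BettiUniverse.hodgeNumber_eq_zero_of_chowRankLEOneUpTo hHD hX hCH (show (n - p) + (n - q) = n - p + (n - q) by omega)
        (show n - p ≤ k₀ by omega) (show n - p < n - q by omega)).1

/-- **`b_{2p}(X) = h^{p,p}(H^{2p}(X))`** for such `X`. [cite: VoisinHodgeI2002, §6.1.3 Cor. 6.13] [cite: VoisinHodgeII2003, Thm. 10.31] -/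
theorem BettiUniverse.finrank_bettiCohomology_two_mul_eq_hodgeNumber_of_chowRankLEOneUpTo (hHD : exists_isReal_hodgeModel) (hX : IsSmoothProjective n X) {k₀ : ℕ} (hCH : ChowRankLEOneUpTo X k₀)
    (hn : n ≤ 2 * k₀ + 2) (p : ℕ) : Module.finrank ℚ (bettiCohomology X (2 * p)) = (BettiUniverse.hodge hHD hX (2 * p)).hodgeNumber p p :=
  BettiUniverse.finrank_bettiCohomology_two_mul_eq_hodgeNumber_of_hodgeTateType hHD hX (BettiUniverse.hodgeTateType_of_chowRankLEOneUpTo hHD hX hCH hn) p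

/-- **`b_{2p+1}(X) = 0`** for such `X` (`ℚ`-Betti numbers; cf. g33-#10 for the complex groups). [cite: VoisinHodgeII2003, Thm. 10.31] [cite: VoisinHodgeI2002, §6.1.3 Cor. 6.13] -/
theorem BettiUniverse.finrank_bettiCohomology_eq_zero_of_chowRankLEOneUpTo_of_odd (hHD : exists_isReal_hodgeModel) (hX : IsSmoothProjective n X) {k₀ : ℕ} (hCH : ChowRankLEOneUpTo X k₀)
    (hn : n ≤ 2 * k₀ + 2) {k : ℕ} (hk : Odd k) : Module.finrank ℚ (bettiCohomology X k) = 0 :=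
  BettiUniverse.finrank_bettiCohomology_eq_zero_of_hodgeTateType hHD hX (BettiUniverse.hodgeTateType_of_chowRankLEOneUpTo hHD hX hCH hn) hk

/-- **`E(X) = Σ_{p ≤ n} h^{p,p}(H^{2p}(X))`** for such `X`. [cite: Hirzebruch1966, §15.8 Thm. 15.8.1] [cite: Yui2013, §1.4 (held text p0221)] [cite: VoisinHodgeII2003, Thm. 10.31] -/
theorem BettiUniverse.eulerChar_eq_sum_hodgeNumber_of_chowRankLEOneUpTo (hHD : exists_isReal_hodgeModel) (hX : IsSmoothProjective n X) {k₀ : ℕ} (hCH : ChowRankLEOneUpTo X k₀) (hn : n ≤ 2 * k₀ + 2) :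
    ∑ k ∈ range (2 * n + 1), (-1 : ℤ) ^ k * (Module.finrank ℚ (bettiCohomology X k) : ℤ) = ∑ p ∈ range (n + 1), ((BettiUniverse.hodge hHD hX (2 * p)).hodgeNumber p p : ℤ) :=
  BettiUniverse.eulerChar_eq_sum_hodgeNumber_of_hodgeTateType hHD hX (BettiUniverse.hodgeTateType_of_chowRankLEOneUpTo hHD hX hCH hn)

/-- **`E(X) ≥ dim X + 1` for a smooth projective `n`-fold with `CH₀, …, CH_{k₀}` of rank `≤ 1` and `n ≤ 2k₀ + 2`** (each `b_{2p} ≥ 1`, all `b_{2p+1} = 0`). [cite: VoisinHodgeI2002, §3.1.3 Cor. 3.9 and §7.1.2]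
[cite: VoisinHodgeII2003, Thm. 10.31] [cite: Yui2013, §1.4 (held text p0221)] -/
theorem BettiUniverse.succ_le_eulerChar_of_chowRankLEOneUpTo (hHD : exists_isReal_hodgeModel) (hX : IsSmoothProjective n X) {k₀ : ℕ} (hCH : ChowRankLEOneUpTo X k₀) (hn : n ≤ 2 * k₀ + 2) :
    (n : ℤ) + 1 ≤ ∑ k ∈ range (2 * n + 1), (-1 : ℤ) ^ k * (Module.finrank ℚ (bettiCohomology X k) : ℤ) :=
  BettiUniverse.succ_le_eulerChar_of_hodgeTateType hHD hX (BettiUniverse.hodgeTateType_of_chowRankLEOneUpTo hHD hX hCH hn)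

/-- **`E(X) > 0`** for such `X`. [cite: VoisinHodgeI2002, §7.1.2] [cite: VoisinHodgeII2003, Thm. 10.31] -/
theorem BettiUniverse.eulerChar_pos_of_chowRankLEOneUpTo (hHD : exists_isReal_hodgeModel) (hX : IsSmoothProjective n X) {k₀ : ℕ} (hCH : ChowRankLEOneUpTo X k₀) (hn : n ≤ 2 * k₀ + 2) :
    0 < ∑ k ∈ range (2 * n + 1), (-1 : ℤ) ^ k * (Module.finrank ℚ (bettiCohomology X k) : ℤ) :=
  BettiUniverse.eulerChar_pos_of_hodgeTateType hHD hX (BettiUniverse.hodgeTateType_of_chowRankLEOneUpTo hHD hX hCH hn)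

/-! ### §2 Instances -/

/-- **Surfaces with `CH₀ ⊗ ℚ` of rank `≤ 1` are of Hodge–Tate type (`p_g = q = 0` and their duals): `h^{p,q}(S) = 0` for `p ≠ q`, hypothesis-free** (the real Hodge model is a theorem of the tree).
[cite: BlochSrinivas1983, Thm. 1] [cite: VoisinHodgeII2003, §10.2.2 Thm. 10.17 and Cor. 10.18] -/
theorem BettiUniverse.hodgeTateType_surface_of_chowRankLEOneUpTo_zero {S : SchemeOver ℂ} (hS : IsSmoothProjective 2 S) (hCH : ChowRankLEOneUpTo S 0) (k p q : ℕ) (hpq : p + q = k) (hne : p ≠ q) :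
    (BettiUniverse.hodge exists_isReal_hodgeModel_holds hS k).hodgeNumber p q = 0 :=
  BettiUniverse.hodgeTateType_of_chowRankLEOneUpTo exists_isReal_hodgeModel_holds hS hCH (by norm_num) k p q hpq hne

/-- **`e(S) ≥ 3` for a smooth projective surface with `CH₀ ⊗ ℚ` of rank `≤ 1`** (`b₁ = b₃ = 0`, `b₀ = b₄ = 1`, `b₂ ≥ 1`). [cite: BlochSrinivas1983, Thm. 1] [cite: VoisinHodgeII2003, §10.2.2 Cor. 10.18] [cite: VoisinHodgeI2002, §7.1.2] -/
theorem BettiUniverse.three_le_eulerChar_surface_of_chowRankLEOneUpTo_zero {S : SchemeOver ℂ} (hS : IsSmoothProjective 2 S) (hCH : ChowRankLEOneUpTo S 0) :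
    (3 : ℤ) ≤ ∑ k ∈ range (2 * 2 + 1), (-1 : ℤ) ^ k * (Module.finrank ℚ (bettiCohomology S k) : ℤ) := by
  have h := BettiUniverse.succ_le_eulerChar_of_chowRankLEOneUpTo exists_isReal_hodgeModel_holds hS hCH (by norm_num)
  push_cast at h
  linarith

/-- **`e(S) ≥ 3` for every rationally chain connected smooth projective surface** (g33-#13's bridge). [cite: Kollar1995, Def. 4.10] [cite: BlochSrinivas1983, Thm. 1] [cite: VoisinHodgeI2002, §7.1.2] -/
theorem BettiUniverse.three_le_eulerChar_surface_of_isRationallyChainConnected {S : SchemeOver ℂ} (hS : IsSmoothProjective 2 S) (hRC : IsRationallyChainConnected S) :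
    (3 : ℤ) ≤ ∑ k ∈ range (2 * 2 + 1), (-1 : ℤ) ^ k * (Module.finrank ℚ (bettiCohomology S k) : ℤ) :=
  BettiUniverse.three_le_eulerChar_surface_of_chowRankLEOneUpTo_zero hS (hRC.chowRankLEOneUpTo_zero hS)

/-- **`e(F) ≥ 3` for every smooth FANO (del Pezzo) surface, granted KMM92.** [cite: KollarMiyaokaMori1992, Thm. 3.3] [cite: BlochSrinivas1983, Thm. 1] [cite: VoisinHodgeI2002, §7.1.2] -/
theorem BettiUniverse.three_le_eulerChar_surface_of_isFano (hKMM : KollarMiyaokaMori1992_fano_rationallyChainConnected) {F : SchemeOver ℂ} (hF : IsFano 2 F) :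
    (3 : ℤ) ≤ ∑ k ∈ range (2 * 2 + 1), (-1 : ℤ) ^ k * (Module.finrank ℚ (bettiCohomology F k) : ℤ) :=
  BettiUniverse.three_le_eulerChar_surface_of_chowRankLEOneUpTo_zero hF.isSmoothProjective (hKMM.chowRankLEOneUpTo_zero hF)

/-- **Fourfolds with `CH₀, CH₁ ⊗ ℚ` of rank `≤ 1` are of Hodge–Tate type** (in particular `h^{4,0} = h^{3,1} = h^{2,0} = h^{1,0} = h^{2,1} = 0`). [cite: VoisinHodgeII2003, Thm. 10.29 and Thm. 10.31] [cite: Laterveer1998, main theorem (as quoted in Vial2013 Thm. 7.1)] -/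
theorem BettiUniverse.hodgeTateType_fourfold_of_chowRankLEOneUpTo_one {F : SchemeOver ℂ} (hF : IsSmoothProjective 4 F) (hCH : ChowRankLEOneUpTo F 1) (k p q : ℕ) (hpq : p + q = k) (hne : p ≠ q) :
    (BettiUniverse.hodge exists_isReal_hodgeModel_holds hF k).hodgeNumber p q = 0 :=
  BettiUniverse.hodgeTateType_of_chowRankLEOneUpTo exists_isReal_hodgeModel_holds hF hCH (by norm_num) k p q hpq hne

/-- **`e(F) ≥ 5` for a smooth projective fourfold with `CH₀, CH₁ ⊗ ℚ` of rank `≤ 1`.** [cite: VoisinHodgeII2003, Thm. 10.31] [cite: VoisinHodgeI2002, §7.1.2] -/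
theorem BettiUniverse.five_le_eulerChar_fourfold_of_chowRankLEOneUpTo_one {F : SchemeOver ℂ} (hF : IsSmoothProjective 4 F) (hCH : ChowRankLEOneUpTo F 1) :
    (5 : ℤ) ≤ ∑ k ∈ range (2 * 4 + 1), (-1 : ℤ) ^ k * (Module.finrank ℚ (bettiCohomology F k) : ℤ) := by
  have h := BettiUniverse.succ_le_eulerChar_of_chowRankLEOneUpTo exists_isReal_hodgeModel_holds hF hCH (by norm_num)
  push_cast at h
  linarith

/-- **`e(Y) ≥ 7` for a smooth projective sixfold with `CH₀, CH₁, CH₂ ⊗ ℚ` of rank `≤ 1`** (Hodge–Tate type). [cite: VoisinHodgeII2003, Thm. 10.31] [cite: VoisinHodgeI2002, §7.1.2] -/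
theorem BettiUniverse.seven_le_eulerChar_sixfold_of_chowRankLEOneUpTo_two {Y : SchemeOver ℂ} (hY : IsSmoothProjective 6 Y) (hCH : ChowRankLEOneUpTo Y 2) :
    (7 : ℤ) ≤ ∑ k ∈ range (2 * 6 + 1), (-1 : ℤ) ^ k * (Module.finrank ℚ (bettiCohomology Y k) : ℤ) := by
  have h := BettiUniverse.succ_le_eulerChar_of_chowRankLEOneUpTo exists_isReal_hodgeModel_holds hY hCH (by norm_num)
  push_cast at h
  linarith

end Literature.AlgebraicGeometry.HodgeTheory

end
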